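import Summits.ResolutionOfSingularities.ResolutionOfSingularities.Theses.PAlteration
import HarnessLib

/-!
# Sketch (crux-ideate round 1, ideator k = 2) — crux `Pialt` (stmt-ResolutionOfSingularities-0555)

First-lemma signatures of the two crux idea cards of this seat. Nothing here is a proof
(`sorry` throughout, except trivial glue); the file must only ELABORATE against the route file.

* Card A `radicially-regular-endgame`: `RadiciallyRegular`, `LocallyRadiciallyRegular`, `ModRR`,
  `TameResolution`, `RadicialPatching`; the REORDERING lemma `modRR_of_pialtPerfect`
  (modification first, one finite radicial cover last) and its converse; composition
  `pialt_of_cardA`.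
* Card B `indeterminacy-split`: `FrobIndet` (purely inseparable elimination of indeterminacy on
  REGULAR proper varieties), `PiRegModel` (every function field acquires a regular proper model
  after a finite purely inseparable extension); the split `pialtPerfect_of_frobIndet_piRegModel`
  and the two converses; composition `pialt_of_cardB`.
* Shared support `PialtPerfectSuffices` (= `stub_pialtOfPerfect` of the 0552 line
  `Cruxes/PalterationThesis/Lines/Sketch.lean`, perfect-closure descent).
-/

set_option linter.dupNamespace false

noncomputable section

open CategoryTheory AlgebraicGeometry TopologicalSpace
open Literature.AlgebraicGeometry.Resolution
open Summit.ResolutionOfSingularities.ResolutionOfSingularities.Theses.PAlteration (Pialt)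

namespace Summit.ResolutionOfSingularities.ResolutionOfSingularities.Cruxes.Pialt.SketchIdeator2

/-! ## §0 The conclusion of the crux at one scheme; perfect ground fields -/

/-- The conclusion of `Pialt` at a single scheme `X` (verbatim shape of the route decl). -/
def PialtShape (X : Scheme.{0}) : Prop :=
  ∃ (X' : Scheme.{0}) (g : X' ⟶ X), IsProper g ∧ IsIntegral X' ∧ Scheme.IsRegular X' ∧
    Function.Surjective g.base ∧ ∃ U : X.Opens, Dense (U : Set X) ∧ IsFinite (g ∣_ U) ∧
      UniversallyInjective (g ∣_ U)

/-- `Pialt` restricted to PERFECT ground fields of characteristic `p`. -/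
def PialtPerfect : Prop :=
  ∀ p : ℕ, p.Prime → ∀ (k : Type) [Field k] [CharP k p] [PerfectField k] (X : Scheme.{0})
    (f : X ⟶ Spec (.of k)), IsSeparated f → LocallyOfFiniteType f → QuasiCompact f →
      IsIntegral X → PialtShape X

/-- SUPPORT (shared; perfect-closure descent, `exists_level_model`-style): perfect ground fields
suffice for the crux. -/
def PialtPerfectSuffices : Prop := PialtPerfect → Pialt

/-- Bookkeeping: the crux unfolds to `PialtShape`. -/
theorem pialt_iff_pialtShape :
    Pialt ↔ ∀ p : ℕ, p.Prime → ∀ (k : Type) [Field k] [CharP k p] (X : Scheme.{0})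
      (f : X ⟶ Spec (.of k)), IsSeparated f → LocallyOfFiniteType f → QuasiCompact f →
        IsIntegral X → PialtShape X :=
  Iff.rfl

/-! ## Card A — `radicially-regular-endgame` -/

/-- `Z` is (globally) **radicially regular**: some integral REGULAR scheme maps onto it by a
finite, universally injective, surjective morphism (a finite universal homeomorphism). Over a
perfect field and for normal `Z` this is the same as being a finite radicial cover OF a regular
scheme (Frobenius domination, in tree: `exists_frobeniusCover_of_finite_universallyInjective`). -/
def RadiciallyRegular (Z : Scheme.{0}) : Prop :=
  ∃ (W : Scheme.{0}) (h : W ⟶ Z), IsIntegral W ∧ Scheme.IsRegular W ∧ IsFinite h ∧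
    UniversallyInjective h ∧ Function.Surjective h.base

/-- The LOCAL version: every point has a radicially regular open neighbourhood. Its failure
locus `NonLRR(Z)` is closed and is the target of the partial resolution `TameResolution`. -/
def LocallyRadiciallyRegular (Z : Scheme.{0}) : Prop :=
  ∀ z : Z, ∃ U : Z.Opens, z ∈ U ∧ RadiciallyRegular (U : Scheme.{0})

/-- `ModRR_p` (over perfect fields): every integral variety has a MODIFICATION (proper
birational, integral source) that is globally radicially regular. -/
def ModRR : Prop :=
  ∀ p : ℕ, p.Prime → ∀ (k : Type) [Field k] [CharP k p] [PerfectField k] (X : Scheme.{0})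
    (f : X ⟶ Spec (.of k)), IsSeparated f → LocallyOfFiniteType f → QuasiCompact f →
      IsIntegral X → ∃ (Z : Scheme.{0}) (π : Z ⟶ X), IsProper π ∧ IsBirational π ∧
        IsIntegral Z ∧ RadiciallyRegular Z

/-- FIRST LEMMA (easy direction): a radicially regular modification IS a purely inseparable
regular alteration (`W → Z → X`; finite + radicial over the dense open where `π` is an iso). -/
theorem pialtPerfect_of_modRR : ModRR → PialtPerfect := by
  sorry

/-- FIRST LEMMA (the REORDERING lemma): conversely every witness `g : X' → X` of the crux (over a
perfect field, `X` normal) factors as `X' → Z → X` with `X' → Z` finite radicial surjective and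
`Z → X` a modification: `Z := (|X'|, 𝒪_{X'} ∩ K(X))` (the radicial hull of `X'` over `K(X)`;
affine-locally `B ↦ B ∩ K`, finitely generated by Artin–Tate, `B` finite over it since
`B^{p^e} ⊆ B ∩ K`). So `Pialt` over perfect fields is EXACTLY "weak resolution with 'regular'
relaxed to 'radicially regular'". -/
theorem modRR_of_pialtPerfect : PialtPerfect → ModRR := by
  sorry

/-- STUB A1 `TameResolution_p` — PARTIAL resolution: every integral variety over a perfect field
has a normal modification all of whose points are LOCALLY radicially regular (the terminal class
contains every purely-inseparable pathology of the barrier catalogue: `z^{p^e} + F`, kangaroo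
points, Narasimhan's `x² + yz³ + zw³ + y⁷w` in char `2`, CP Rem. 3.2). -/
def TameResolution : Prop :=
  ∀ p : ℕ, p.Prime → ∀ (k : Type) [Field k] [CharP k p] [PerfectField k] (X : Scheme.{0})
    (f : X ⟶ Spec (.of k)), IsSeparated f → LocallyOfFiniteType f → QuasiCompact f →
      IsIntegral X → ∃ (Z : Scheme.{0}) (π : Z ⟶ X), IsProper π ∧ IsBirational π ∧
        IsIntegral Z ∧ (∀ z : Z, IsIntegrallyClosed (Z.presheaf.stalk z)) ∧
          LocallyRadiciallyRegular Z

/-- STUB A2 `RadicialPatching_p` — local-to-global: a normal integral variety over a perfect field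
that is LOCALLY radicially regular satisfies the conclusion of the crux (one global finite purely
inseparable field extension, after a further modification if needed). -/
def RadicialPatching : Prop :=
  ∀ p : ℕ, p.Prime → ∀ (k : Type) [Field k] [CharP k p] [PerfectField k] (Z : Scheme.{0})
    (f : Z ⟶ Spec (.of k)), IsSeparated f → LocallyOfFiniteType f → QuasiCompact f →
      IsIntegral Z → (∀ z : Z, IsIntegrallyClosed (Z.presheaf.stalk z)) →
        LocallyRadiciallyRegular Z → PialtShape Z

/-- Composition of Card A (the future `Pialt_of`): tame resolution, then radicial patching on the
modification, then compose with the modification (a p.i. alteration followed by a modification is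
a p.i. alteration), then leave perfect fields by the shared support. -/
theorem pialt_of_cardA (hP : PialtPerfectSuffices) (hT : TameResolution)
    (hR : RadicialPatching) : Pialt := by
  refine hP ?_
  sorry

/-! ## Card B — `indeterminacy-split` -/

/-- STUB B1 `FrobIndet_p` — purely inseparable ELIMINATION OF INDETERMINACY on regular proper
varieties: a rational map `φ : Y ⇢ X` from a regular proper integral `Y` to a proper `X`, defined
on a non-empty open `U`, becomes a morphism after a purely inseparable REGULAR alteration
`g : Y' → Y` (compatibly with `φ` over `U`). Equivalently: `PialtShape (Bl_I Y)` for every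
coherent ideal `I` on a regular `Y` (p.i. principalization). Special case of the crux. -/
def FrobIndet : Prop :=
  ∀ p : ℕ, p.Prime → ∀ (k : Type) [Field k] [CharP k p] [PerfectField k] (Y X : Scheme.{0})
    (fY : Y ⟶ Spec (.of k)) (fX : X ⟶ Spec (.of k)), IsProper fY → IsProper fX →
      IsIntegral Y → Scheme.IsRegular Y → IsIntegral X →
      ∀ (U : Y.Opens) (φ : (U : Scheme.{0}) ⟶ X), (U : Set Y).Nonempty → U.ι ≫ fY = φ ≫ fX →
        ∃ (Y' : Scheme.{0}) (g : Y' ⟶ Y) (ψ : Y' ⟶ X), IsProper g ∧ IsIntegral Y' ∧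
          Scheme.IsRegular Y' ∧ Function.Surjective g.base ∧
          (∃ V : Y.Opens, Dense (V : Set Y) ∧ IsFinite (g ∣_ V) ∧
            UniversallyInjective (g ∣_ V)) ∧
          (g ⁻¹ᵁ U).ι ≫ ψ = (g ∣_ U) ≫ φ

/-- STUB B2 `PiRegModel_p` — every function field becomes "smoothable" after a finite purely
inseparable extension: for every proper integral `X` over a perfect field there is a proper
integral REGULAR `Y` and a non-empty open `V ⊆ Y` which is a finite radicial cover of an open of
`X` (i.e. `K(Y) ⊇ K(X)` finite purely inseparable). No morphism `Y → X` is asked for. -/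
def PiRegModel : Prop :=
  ∀ p : ℕ, p.Prime → ∀ (k : Type) [Field k] [CharP k p] [PerfectField k] (X : Scheme.{0})
    (f : X ⟶ Spec (.of k)), IsProper f → IsIntegral X →
      ∃ (Y : Scheme.{0}) (h : Y ⟶ Spec (.of k)), IsProper h ∧ IsIntegral Y ∧
        Scheme.IsRegular Y ∧
        ∃ (U : X.Opens) (V : Y.Opens) (ψ : (V : Scheme.{0}) ⟶ (U : Scheme.{0})),
          (U : Set X).Nonempty ∧ IsFinite ψ ∧ UniversallyInjective ψ ∧
            Function.Surjective ψ.base ∧ V.ι ≫ h = ψ ≫ U.ι ≫ f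

/-- FIRST LEMMA of Card B (the split): `FrobIndet ∧ PiRegModel ⇒ Pialt` over perfect fields —
take the regular model `Y` of B2, the rational map `Y ⇢ X` it carries (`V → U ↪ X`), eliminate
its indeterminacy by B1, and compose: `Y' → X` is proper, generically finite radicial, `Y'`
regular. (Reduction of the crux to proper/projective `X` is in tree:
`pialt_iff_forall_isProjectiveOver`.) -/
theorem pialtPerfect_of_frobIndet_piRegModel : FrobIndet → PiRegModel → PialtPerfect := by
  sorry

/-- Converse 1: B1 is a special case of the crux (apply it to the closure of the graph of `φ`). -/
theorem frobIndet_of_pialtPerfect : PialtPerfect → FrobIndet := by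
  sorry

/-- Converse 2: B2 is weaker than the crux (forget the morphism to `X`). So over perfect fields
`Pialt ↔ FrobIndet ∧ PiRegModel`, and granted B1 the conclusion of the crux becomes a BIRATIONAL
invariant (in both directions) and an invariant of the purely-inseparable commensurability class
of the function field. -/
theorem piRegModel_of_pialtPerfect : PialtPerfect → PiRegModel := by
  sorry

/-- Composition of Card B (the future `Pialt_of`). -/
theorem pialt_of_cardB (hP : PialtPerfectSuffices) (hI : FrobIndet) (hM : PiRegModel) : Pialt :=
  hP (pialtPerfect_of_frobIndet_piRegModel hI hM)

end Summit.ResolutionOfSingularities.ResolutionOfSingularities.Cruxes.Pialt.SketchIdeator2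

end
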